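import Literature.NumberTheory.LFunctions.FordLargeLambdaTail
import Literature.NumberTheory.LFunctions.FordLargeLambdaCore2
import HarnessLib

/-!
# Ford's Theorem 2 for `λ ≥ 2025` from the row of (1.7) with `k ≥ 1191` and Theorem 4'

Topic `Literature/NumberTheory/LFunctions`. Pure proof file (no `def`): the tail theorem
`FordVK.Tail.expSum_bound_lambda_ge_2025` (`FordLargeLambdaTail.lean`) re-run through
`FordVK.sec5_interval2` (`FordLargeLambdaCore2.lean`).  In the tail `k = ⌊λ/κ + 3·10⁻⁶⌋ ≥ 3118`, so
only the row of (1.7) for `k ≥ 1191` is needed — which the tree proves with the PRINTED constants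
`(3.21432, 2.3291)` (`FordVK.LargeK.row_ge_1191`) — and Theorem 4 enters in the library form
Theorem 4' (`hT4'`, the shape of `FordVK.ford_theorem4_lib`).  All analytic side conditions
(`Tail.tail_c8`, `Tail.tail_c9`, the box certificate `Tail.checkAll`) are reused unchanged; the one
new side condition `k² ≤ 120 s` holds with room (`k ≤ 1.5405λ`, `s ≥ 0.3299·1.1815·0.0629 λ²`).
The price is the constant: `10.031` for `9.463`.

* `FordVK.Tail.expSum_bound_lambda_ge_2025_v2` — Theorem 2 for `t ≥ N^{2025}`, constant `10.031`,
  from `hT3d` (row of (1.7), `k ≥ 1191`), `hT4'` and the box certificate (hypothesis `hbox`);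
* `FordVK.Tail.expSum_bound_lambda_ge_2025_v2'` — the same with `hbox` discharged by the kernel
  (`Tail.checkAll_true`).

## References
* K. Ford, Proc. London Math. Soc. (3) 85 (2002), 565–633; arXiv:1910.08209: Theorem 2, §5,
  (5.13)–(5.31), Lemma 5.2. [Ford2002]
-/

open Finset Real

namespace Literature.NumberTheory.LFunctions
namespace FordVK
namespace Tail

/-- **Theorem 2 of [Ford2002] in the tail `λ ≥ 2025`, constant `10.031`**, from the row of (1.7)
with `k ≥ 1191` (`hT3d`), Theorem 4' (`hT4'`) and the box certificate `Tail.checkAll` (`hbox`): for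
`1 ≤ N < R₀ ≤ 2N`, `0 < u ≤ 1`, `t ≥ N^{2025}`,
`|∑_{N<n≤R₀} (n+u)^{-it}| ≤ 10.031 · N^{1 − log²N/(133.66 log²t)}`.  Ford's parameters:
`k = ⌊λ/κ + 3·10⁻⁶⌋`, `h = ⌊γ₀λ + ½⌋`, `g = ⌊(γ₀+δ₀)λ + ½⌋`, `s = ⌊σh(g−h)⌋ + 1`, `η = 1/(7g⌊√g⌋)`,
`w⁺ = ⌈182 g⌊√g⌋/25⌉`. [cite: Ford2002, Theorem 2, §5 (5.13)–(5.31), Lemma 5.2] -/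
theorem expSum_bound_lambda_ge_2025_v2
    (hT3d : ∀ k : ℕ, 1191 ≤ k → ∃ s₃ : ℕ, 1 ≤ s₃ ∧ (s₃ : ℝ) ≤ 3.21432 * (k : ℝ) ^ 2 ∧ ∀ P : ℕ, 1 ≤ P →
      (VMV.J k s₃ (Finset.Icc (1 : ℤ) P) : ℝ) ≤ (k : ℝ) ^ (2.3291 * (k : ℝ) ^ 3)
        * (P : ℝ) ^ ((2 * s₃ : ℝ) - ((k * (k + 1) / 2 : ℕ) : ℝ) + 0.001 * (k : ℝ) ^ 2))
    (hT4' : ∀ (k h s : ℕ) (P η D : ℝ), 60 ≤ k → (0.9 : ℝ) * k ≤ h → h + 2 ≤ k →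
      2 * (k - h + 1) ≤ s → s ≤ (h / 2) * (k - h + 1) → 10 ≤ D → Real.exp (D * (k : ℝ) ^ 2) ≤ P →
      2 / (k : ℝ) ^ 3 < η → η ≤ 1 / (2 * (k : ℝ)) →
      18 / (k : ℝ) ≤ 4 * Real.log k / (D * (k : ℝ) ^ 2 * η) →
      4 * Real.log k / (D * (k : ℝ) ^ 2 * η) ≤ 0.4 → 80 ≤ η * Real.log P →
      (Jinc k s ((calC P (P ^ η)).map Nat.castEmbedding) h k : ℝ)
        ≤ Real.exp ((s : ℝ) ^ 2 / ((k : ℝ) - h + 1)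
            + 10.5 * ((k : ℝ) - h + 1) * Real.log k ^ 2 / (D * k * η ^ 2)
            - s * ((1 / η + h) * (1 - 1 / (h : ℝ)) ^ ((s : ℝ) / ((k : ℝ) - h + 1)) - h)
              * Real.log (1 / (12 * η)))
          * P ^ ((2 * s : ℝ) - ((k : ℝ) - h + 1) / 2 * (h + k) + ((k : ℝ) - h + 1) * ((k : ℝ) - h) / 2
            + η * (s : ℝ) ^ 2 / (2 * ((k : ℝ) - h + 1))
            + h * ((k : ℝ) - h + 1) * Real.exp (-(s : ℝ) / (h * ((k : ℝ) - h + 1)))))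
    (hbox : checkAll = true)
    {N R₀ : ℕ} {t u : ℝ} (hN : 1 ≤ N) (hNR : N < R₀) (hR : R₀ ≤ 2 * N) (hu0 : 0 < u) (hu1 : u ≤ 1)
    (ht1 : (N : ℝ) ^ (2025 : ℕ) ≤ t) :
    ‖∑ n ∈ Ioc N R₀, ((n : ℂ) + u) ^ (-(t * Complex.I))‖
      ≤ 10.031 * (N : ℝ) ^ (1 - Real.log N ^ 2 / (133.66 * Real.log t ^ 2)) := by
  have hS := norm_shifted_sum_le_trivial hR hu0 (t := t)
  rcases eq_or_lt_of_le hN with hN1 | hN2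
  · subst hN1
    simp only [Nat.cast_one, Real.one_rpow, mul_one] at hS ⊢
    exact hS.trans (by norm_num)
  have hN0 : (0 : ℝ) < N := by positivity
  have hN1' : (1 : ℝ) < N := by exact_mod_cast hN2
  have hL : 0 < Real.log N := Real.log_pos hN1'
  have hNpow : (1 : ℝ) < (N : ℝ) ^ (2025 : ℕ) := one_lt_pow₀ hN1' (by norm_num)
  have ht1' : 1 < t := lt_of_lt_of_le hNpow ht1
  have ht0 : 0 < t := by linarith only [ht1']
  have hlog1 : (2025 : ℝ) * Real.log N ≤ Real.log t := by
    have := Real.log_le_log (by positivity) ht1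
    rwa [Real.log_pow, Nat.cast_ofNat] at this
  by_cases hsmall : Real.log N ^ 3 ≤ 300 * Real.log t ^ 2
  · exact (expSum_bound_trivial_range hN hR hu0 ht1' hsmall).trans
      (mul_le_mul_of_nonneg_right (by norm_num) (by positivity))
  push Not at hsmall
  have hbig : 300 * (Real.log t / Real.log N) ^ 2 ≤ Real.log N := by
    rw [div_pow, ← mul_div_assoc, div_le_iff₀ (pow_pos hL 2)]
    nlinarith only [hsmall]
  obtain ⟨lam, hlam⟩ : ∃ x : ℝ, x = Real.log t / Real.log N := ⟨_, rfl⟩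
  have hl25 : 2025 ≤ lam := by rw [hlam, le_div_iff₀ hL]; exact hlog1
  have hlam0 : 0 < lam := by linarith only [hl25]
  -- ### the parameters
  obtain ⟨kN, hkN⟩ : ∃ n : ℕ, n = ⌊lam / 0.6492 + 3 / 1000000⌋₊ := ⟨_, rfl⟩
  obtain ⟨hh, hhh⟩ : ∃ n : ℕ, n = ⌊1.1818 * lam + 1 / 2⌋₊ := ⟨_, rfl⟩
  obtain ⟨gN, hgN⟩ : ∃ n : ℕ, n = ⌊1.2453 * lam + 1 / 2⌋₊ := ⟨_, rfl⟩
  obtain ⟨m1, hm1⟩ : ∃ n : ℕ, n = ⌊lam / (1 - 0.1905)⌋₊ := ⟨_, rfl⟩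
  obtain ⟨m2, hm2⟩ : ∃ n : ℕ, n = ⌊lam / (1 - 0.1603)⌋₊ := ⟨_, rfl⟩
  obtain ⟨qN, hqN⟩ : ∃ n : ℕ, n = Nat.sqrt gN := ⟨_, rfl⟩
  obtain ⟨sN, hsN⟩ : ∃ n : ℕ, n = ⌊0.3299 * (hh : ℝ) * ((gN : ℝ) - hh)⌋₊ + 1 := ⟨_, rfl⟩
  obtain ⟨wpN, hwpN⟩ : ∃ n : ℕ, n = (182 * gN * qN + 24) / 25 := ⟨_, rfl⟩
  obtain ⟨η, hη⟩ : ∃ x : ℝ, x = 1 / (7 * (gN : ℝ) * qN) := ⟨_, rfl⟩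
  -- ### real windows
  have e6492 : lam / 0.6492 = lam * (2500 / 1623) := by rw [div_eq_mul_one_div]; norm_num
  have hk_lo : lam / 0.6492 + 3 / 1000000 < (kN : ℝ) + 1 := by rw [hkN]; exact Nat.lt_floor_add_one _
  have hk_hi : (kN : ℝ) ≤ lam / 0.6492 + 3 / 1000000 := by rw [hkN]; exact Nat.floor_le (by positivity)
  rw [e6492] at hk_lo hk_hi
  have hk1 : lam * (2500 / 1623 - 1 / lam) ≤ kN := by
    have e : lam * (2500 / 1623 - 1 / lam) = lam * (2500 / 1623) - 1 := by field_simp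
    rw [e]; linarith only [hk_lo]
  have hk2 : (kN : ℝ) ≤ lam * (2500 / 1623 + 3 / 1000000 * (1 / lam)) := by
    have e : lam * (2500 / 1623 + 3 / 1000000 * (1 / lam)) = lam * (2500 / 1623) + 3 / 1000000 := by
      field_simp
    rw [e]; exact hk_hi
  have hk1' : 1.5398 * lam ≤ kN := by linarith only [hk_lo, hl25]
  have hk2' : (kN : ℝ) ≤ 1.5405 * lam := by linarith only [hk_hi, hl25]
  have hh_lo : 1.1818 * lam + 1 / 2 < (hh : ℝ) + 1 := by rw [hhh]; exact Nat.lt_floor_add_one _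
  have hh_hi : (hh : ℝ) ≤ 1.1818 * lam + 1 / 2 := by rw [hhh]; exact Nat.floor_le (by positivity)
  have hg_lo : 1.2453 * lam + 1 / 2 < (gN : ℝ) + 1 := by rw [hgN]; exact Nat.lt_floor_add_one _
  have hg_hi : (gN : ℝ) ≤ 1.2453 * lam + 1 / 2 := by rw [hgN]; exact Nat.floor_le (by positivity)
  have hh1 : 1.1815 * lam ≤ hh := by linarith only [hh_lo, hl25]
  have hh2 : (hh : ℝ) ≤ 1.1821 * lam := by linarith only [hh_hi, hl25]
  have hg1 : 1.2450 * lam ≤ gN := by linarith only [hg_lo, hl25]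
  have hg2 : (gN : ℝ) ≤ 1.2456 * lam := by linarith only [hg_hi, hl25]
  have hgh : (hh : ℝ) + 2 ≤ gN := by linarith only [hh2, hg1, hl25]
  have hhg : hh ≤ gN := by
    have : (hh : ℝ) ≤ gN := by linarith only [hgh]
    exact_mod_cast this
  have hgh0 : (0 : ℝ) ≤ (gN : ℝ) - hh := by linarith only [hgh]
  have hX0 : 0 ≤ 0.3299 * (hh : ℝ) * ((gN : ℝ) - hh) := by positivity
  have hsR : (sN : ℝ) = (⌊0.3299 * (hh : ℝ) * ((gN : ℝ) - hh)⌋₊ : ℝ) + 1 := by rw [hsN]; push_cast; ring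
  have hs1 : 0.3299 * (hh : ℝ) * ((gN : ℝ) - hh) ≤ sN := by
    rw [hsR]; exact (Nat.lt_floor_add_one _).le
  have hs2 : (sN : ℝ) ≤ 0.3299 * (hh : ℝ) * ((gN : ℝ) - hh) + 1 := by
    rw [hsR]; linarith only [Nat.floor_le hX0]
  have hm1a : (m1 : ℝ) ≤ lam / (1 - 0.1905) := by
    rw [hm1]; exact Nat.floor_le (div_nonneg hlam0.le (by norm_num))
  have hm1b : lam / (1 - 0.1905) < (m1 : ℝ) + 1 := by rw [hm1]; exact Nat.lt_floor_add_one _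
  have hm2a : (m2 : ℝ) ≤ lam / (1 - 0.1603) := by
    rw [hm2]; exact Nat.floor_le (div_nonneg hlam0.le (by norm_num))
  have hm2b : lam / (1 - 0.1603) < (m2 : ℝ) + 1 := by rw [hm2]; exact Nat.lt_floor_add_one _
  -- `q = ⌊√g⌋`
  have hg2500 : 2500 ≤ gN := by
    have : (2500 : ℝ) ≤ gN := by linarith only [hg1, hl25]
    exact_mod_cast this
  have hq50 : 50 ≤ qN := by rw [hqN, Nat.le_sqrt]; omega
  have hq2N : qN ^ 2 ≤ gN := by rw [hqN]; exact Nat.sqrt_le' gN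
  have hq3N : gN < (qN + 1) ^ 2 := by rw [hqN]; exact Nat.lt_succ_sqrt' gN
  have hq50r : (50 : ℝ) ≤ qN := by exact_mod_cast hq50
  have hq2 : (qN : ℝ) ^ 2 ≤ gN := by exact_mod_cast hq2N
  have hq3 : (gN : ℝ) < ((qN : ℝ) + 1) ^ 2 := by exact_mod_cast hq3N
  have hq0 : (0 : ℝ) < qN := by linarith only [hq50r]
  have hg0 : (0 : ℝ) < gN := by linarith only [hg1, hl25]
  -- `η`, `w⁺`
  have hgq : (0 : ℝ) < 7 * (gN : ℝ) * qN := by positivity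
  have hηeq : η * (7 * (gN : ℝ) * qN) = 1 := by rw [hη]; field_simp
  have hη0 : 0 < η := by rw [hη]; positivity
  have hηinv : 1 / η = 7 * (gN : ℝ) * qN := by rw [hη, one_div_one_div]
  have hwp_nat : 182 * gN * qN ≤ 25 * wpN ∧ 25 * wpN ≤ 182 * gN * qN + 24 := by
    rw [hwpN]; constructor <;> omega
  have hwp1 : 182 * (gN : ℝ) * qN / 25 ≤ wpN := by
    rw [div_le_iff₀ (by norm_num)]
    have : ((182 * gN * qN : ℕ) : ℝ) ≤ ((25 * wpN : ℕ) : ℝ) := by exact_mod_cast hwp_nat.1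
    push_cast at this
    linarith only [this]
  have hwp2 : (wpN : ℝ) ≤ 182 * (gN : ℝ) * qN / 25 + 1 := by
    have : ((25 * wpN : ℕ) : ℝ) ≤ ((182 * gN * qN + 24 : ℕ) : ℝ) := by exact_mod_cast hwp_nat.2
    push_cast at this
    linarith only [this]
  have hwp0 : (1 : ℝ) ≤ wpN := by
    have : (25 : ℝ) ≤ 182 * (gN : ℝ) * qN := by nlinarith only [hg0, hq50r, hg1, hl25]
    linarith only [this, hwp1]
  -- `r_f = ⌊ρk²⌋`
  have hrf1 : 3.21432 * (kN : ℝ) ^ 2 - 1 ≤ (⌊3.21432 * (kN : ℝ) ^ 2⌋₊ : ℝ) := by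
    linarith only [Nat.lt_floor_add_one (3.21432 * (kN : ℝ) ^ 2)]
  have hrf2 : (⌊3.21432 * (kN : ℝ) ^ 2⌋₊ : ℝ) ≤ 3.21432 * (kN : ℝ) ^ 2 := Nat.floor_le (by positivity)
  obtain ⟨hr762, _, hshi, _, _⟩ := tail_basic hl25 hk1' hrf1 hh1 hh2 hg1 hg2 hs1 hs2
  -- ### (1.10)
  obtain ⟨c4a, c4b, c4c, c4d⟩ := tail_c4 (by exact_mod_cast hg2500) hq50r hq2 hq3 hηeq
  -- ### the constant condition
  have hF : Real.log ((4 : ℝ) ^ gN) = (gN : ℝ) * Real.log 4 := by rw [Real.log_pow]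
  have c8 := tail_c8 (F := (4 : ℝ) ^ gN) hl25 hk1' hk2' hrf1 hrf2 hh1 hh2 hg1 hg2 hs1 hs2 hq50r hq2 hwp0 hwp2
    hηeq (by positivity) hF
  have hk1191 : 1191 ≤ kN := by
    have : (1191 : ℝ) ≤ kN := by linarith only [hk1', hl25]
    exact_mod_cast this
  -- `k² ≤ 120 s`
  have hks : kN ^ 2 ≤ 120 * sN := by
    have p1 := mul_le_mul hh1 (show 0.0629 * lam ≤ (gN : ℝ) - hh by linarith only [hg1, hh2])
      (by positivity) (by positivity)
    have p2 : (kN : ℝ) ^ 2 ≤ (1.5405 * lam) ^ 2 := pow_le_pow_left₀ (by positivity) hk2' 2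
    have : ((kN ^ 2 : ℕ) : ℝ) ≤ ((120 * sN : ℕ) : ℝ) := by
      push_cast
      nlinarith only [p1, p2, hs1, hl25]
    exact_mod_cast this
  -- ### apply the interval theorem
  refine (sec5_interval2 (k := kN) (h := hh) (g := gN) (s := sN) (m₁ := m1) (m₂ := m2) (wp := wpN)
    (lamlo := lam) (lamhi := lam) (η := η) (ρ := 3.21432) (θ := 2.3291) (θ₁ := 2.3291) (Ctar := 9.463)
    (hT3d kN hk1191) hT4'
    (by linarith only [hl25]) le_rfl hη0 (by norm_num) (by norm_num) (by norm_num) hks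
    ?c1 ?c2a ?c2b ?c2c ?c2d ?c2e ?c3 c4a c4b c4c c4d
    (tail_c5a hl25 hg1 hg2 hq0 hq2 hηeq) ?c5b ?c5c ?c6a ?c6b ?c6c ?c6d ?c6e ?c6f ?c6g ?c7a ?c7b ?c7c
    c8 ?c9 hN2 hNR hR hu0 hu1 ht0 ?hlo ?hhi hbig).trans
    (mul_le_mul_of_nonneg_right (by norm_num) (by positivity))
  case c1 =>
    have e : 0.6492 * (lam * (2500 / 1623) + 3 / 1000000) = lam + 0.6492 * 3 / 1000000 := by norm_num; ring
    have := mul_lt_mul_of_pos_left hk_lo (by norm_num : (0:ℝ) < 0.6492)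
    rw [e] at this
    linarith only [this]
  case c2a =>
    have : (60 : ℝ) ≤ gN := by linarith only [hg1, hl25]
    exact_mod_cast this
  case c2b => linarith only [hh1, hg2, hl25]
  case c2c => exact_mod_cast hgh
  case c2d =>
    have key : ((2 * (gN - hh + 1) : ℕ) : ℝ) ≤ sN := by
      push_cast [Nat.cast_sub hhg]
      have t1 : 1.1815 * lam * ((gN : ℝ) - hh) ≤ (hh : ℝ) * ((gN : ℝ) - hh) :=
        mul_le_mul_of_nonneg_right hh1 hgh0
      nlinarith only [t1, hgh, hl25, hs1, hgh0]
    exact_mod_cast key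
  case c2e => exact tail_c2e (by linarith only [hh1, hl25]) hgh hs2
  case c3 => nlinarith only [hg2, hg0, hl25]
  case c5b => rw [hηinv]; nlinarith only [hg0, hq50r, hg1, hl25]
  case c5c =>
    rw [hηinv]
    have : 26 * (7 * (gN : ℝ) * qN) / 25 = 182 * (gN : ℝ) * qN / 25 := by ring
    rw [this]; exact hwp1
  case c6a =>
    have : (hh : ℝ) ≤ (m2 : ℝ) + 1 := by
      have e : lam / (1 - 0.1603) = lam * (10000 / 8397) := by rw [div_eq_mul_one_div]; norm_num
      rw [e] at hm2b; linarith only [hm2b, hh_hi, hl25]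
    exact_mod_cast this
  case c6b =>
    rw [hm1, hm2]
    exact Nat.floor_le_floor (div_le_div_of_nonneg_left hlam0.le (by norm_num) (by norm_num))
  case c6c =>
    have : (m1 : ℝ) ≤ gN := by
      have e : lam / (1 - 0.1905) = lam * (10000 / 8095) := by rw [div_eq_mul_one_div]; norm_num
      rw [e] at hm1a; linarith only [hm1a, hg_lo, hl25]
    exact_mod_cast this
  case c6d => exact (le_div_iff₀ (by norm_num)).1 hm2a
  case c6e => exact ((div_lt_iff₀ (by norm_num)).1 hm2b).le
  case c6f => exact (le_div_iff₀ (by norm_num)).1 hm1a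
  case c6g => exact ((div_lt_iff₀ (by norm_num)).1 hm1b).le
  case c7a =>
    have : (sN : ℝ) ≤ (⌊3.21432 * (kN : ℝ) ^ 2⌋₊ : ℝ) + 1 := by nlinarith only [hshi, hr762, hl25]
    exact_mod_cast this
  case c7b =>
    have : (1 : ℝ) ≤ hh := by linarith only [hh1, hl25]
    exact_mod_cast this
  case c7c =>
    have : (gN : ℝ) ≤ kN := by linarith only [hg2, hk1', hl25]
    exact_mod_cast this
  case c9 =>
    intro lstar hl
    have hl' : lstar = lam := hl.elim id id
    subst hl'
    have hu1' : 1.1818 - 1 / 4050 ≤ (hh : ℝ) / lstar := by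
      rw [le_div_iff₀ hlam0]; linarith only [hh_lo, hl25]
    have hu2' : (hh : ℝ) / lstar ≤ 1.1818 + 1 / 4050 := by
      rw [div_le_iff₀ hlam0]; linarith only [hh_hi, hl25]
    have hd1' : 0.0635 - 1 / 2025 ≤ ((gN : ℝ) - hh) / lstar := by
      rw [le_div_iff₀ hlam0]; linarith only [hg_lo, hh_hi, hl25]
    have hd2' : ((gN : ℝ) - hh) / lstar ≤ 0.0635 + 1 / 2025 := by
      rw [div_le_iff₀ hlam0]; linarith only [hg_hi, hh_lo, hl25]
    exact tail_c9 hbox hl25 hk1 hk2 hrf1 hrf2 (by linarith only [hh1, hl25]) hgh hs1 hs2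
      (tail_eta_le hl25 hg1 hg2 hq0 hq3 hηeq) hm1a hm1b hm2a hm2b hu1' hu2' hd1' hd2'
  case hlo => rw [hlam, div_mul_cancel₀ _ hL.ne']
  case hhi => rw [hlam, div_mul_cancel₀ _ hL.ne']

/-- **Theorem 2 of [Ford2002] for `t ≥ N^{2025}`, constant `10.031`**, from the row of (1.7) with
`k ≥ 1191` and Theorem 4', the box certificate being discharged by the kernel.
[cite: Ford2002, Theorem 2, §5, Lemma 5.2] -/
theorem expSum_bound_lambda_ge_2025_v2'
    (hT3d : ∀ k : ℕ, 1191 ≤ k → ∃ s₃ : ℕ, 1 ≤ s₃ ∧ (s₃ : ℝ) ≤ 3.21432 * (k : ℝ) ^ 2 ∧ ∀ P : ℕ, 1 ≤ P →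
      (VMV.J k s₃ (Finset.Icc (1 : ℤ) P) : ℝ) ≤ (k : ℝ) ^ (2.3291 * (k : ℝ) ^ 3)
        * (P : ℝ) ^ ((2 * s₃ : ℝ) - ((k * (k + 1) / 2 : ℕ) : ℝ) + 0.001 * (k : ℝ) ^ 2))
    (hT4' : ∀ (k h s : ℕ) (P η D : ℝ), 60 ≤ k → (0.9 : ℝ) * k ≤ h → h + 2 ≤ k →
      2 * (k - h + 1) ≤ s → s ≤ (h / 2) * (k - h + 1) → 10 ≤ D → Real.exp (D * (k : ℝ) ^ 2) ≤ P →
      2 / (k : ℝ) ^ 3 < η → η ≤ 1 / (2 * (k : ℝ)) →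
      18 / (k : ℝ) ≤ 4 * Real.log k / (D * (k : ℝ) ^ 2 * η) →
      4 * Real.log k / (D * (k : ℝ) ^ 2 * η) ≤ 0.4 → 80 ≤ η * Real.log P →
      (Jinc k s ((calC P (P ^ η)).map Nat.castEmbedding) h k : ℝ)
        ≤ Real.exp ((s : ℝ) ^ 2 / ((k : ℝ) - h + 1)
            + 10.5 * ((k : ℝ) - h + 1) * Real.log k ^ 2 / (D * k * η ^ 2)
            - s * ((1 / η + h) * (1 - 1 / (h : ℝ)) ^ ((s : ℝ) / ((k : ℝ) - h + 1)) - h)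
              * Real.log (1 / (12 * η)))
          * P ^ ((2 * s : ℝ) - ((k : ℝ) - h + 1) / 2 * (h + k) + ((k : ℝ) - h + 1) * ((k : ℝ) - h) / 2
            + η * (s : ℝ) ^ 2 / (2 * ((k : ℝ) - h + 1))
            + h * ((k : ℝ) - h + 1) * Real.exp (-(s : ℝ) / (h * ((k : ℝ) - h + 1)))))
    {N R₀ : ℕ} {t u : ℝ} (hN : 1 ≤ N) (hNR : N < R₀) (hR : R₀ ≤ 2 * N) (hu0 : 0 < u) (hu1 : u ≤ 1)
    (ht1 : (N : ℝ) ^ (2025 : ℕ) ≤ t) :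
    ‖∑ n ∈ Ioc N R₀, ((n : ℂ) + u) ^ (-(t * Complex.I))‖
      ≤ 10.031 * (N : ℝ) ^ (1 - Real.log N ^ 2 / (133.66 * Real.log t ^ 2)) :=
  expSum_bound_lambda_ge_2025_v2 hT3d hT4' checkAll_true hN hNR hR hu0 hu1 ht1

end Tail
end FordVK
end Literature.NumberTheory.LFunctions
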